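import Mathlib
import Summits.ValiantsHypothesis.ValiantsHypothesis.Theorems.FifoMatchingNNLinearDegreeCofactorHardInflateWordDefs
import Summits.ValiantsHypothesis.ValiantsHypothesis.Theorems.FifoMatchingNNMonotoneHardQueue
import HarnessLib

/-!
# Crux `NNLinearDegreeCofactorHard` (stmt-ValiantsHypothesis-23918), line `internal_cofactor`, stub S2b (ii):
# the inflated queue word — RANKS, `R`-AVOIDANCE, STRICT PAST, and the closed form of `need` (unit (A″), part 2)

Bookkeeping for the word `InflateWord.inflateWord` of `…InflateWordDefs.lean` (SPEC `Lines/internal_cofactor-S2b-SPEC.md`):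

* V-ranks and V-positions: `vrank_coe`, `vrank_mono`, `vrank_le`, `vrank_succ` (the V-rank steps exactly at non-defect
  positions), `vrank_of_le`, `vpos_lt/_le/_eq/_not_mem`, `vrank_vpos` / `vpos_vrank` (mutually inverse on non-defect
  positions), `vpos_lt_vpos`, `tailStart_le`;
* S1 ⇒ 𝓕_R: `not_mem_of_inflateWord` (every opener is a non-defect position) and `fifo_inflateWord_not_mem` (the FIFO
  pairing of the word never pairs two defects — the support condition of p3's `AvoidingSpread` interface);
* the strict past (what the test lemmas need): `inflateWord_eq_of_agree` — bit strings agreeing below `2j` give words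
  agreeing at every position of V-rank `< 2j` before the tail;
* the envelope recursion S3 unfolded: `need_of_mem` (`+1` across a defect), `need_of_not_mem` (`−1` at an inflation
  pair start, else carried), and the closed form `need_add_card_eq`:
  `need t + #{inflation pair starts in [t, E′)} = #(R ∩ [t, E′))` for `t ≤ E′`.

Honest framing: bookkeeping for ONE unit of an OPEN stub's measure construction; nothing here proves S2b, the crux,
`NNDivisionHard`, `NNNotVP` or VP ≠ VNP.  No definitions, no named facts.
-/

noncomputable section

-- Sub = Summit single-conjunct layout: the duplicated namespace component is mandated by the tree.
set_option linter.dupNamespace false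

namespace Summit.ValiantsHypothesis.ValiantsHypothesis.Theorems.FifoMatching.NNLinearDegreeCofactorHard.InflateWord

open Finset Literature.Computability.AlgebraicComplexity
open Summit.ValiantsHypothesis.ValiantsHypothesis.Theorems.FifoMatching.NNMonotoneHard

variable {N : ℕ} (R : Finset (Fin N))

/-! ### V-rank and V-position -/

/-- On `Fin N` the V-rank is the rank in `Rᶜ` for the `Fin` order. [folklore] -/
theorem vrank_coe (t : Fin N) : vrank R t = (Rᶜ.filter fun i => i < t).card := by
  unfold vrank
  congr 1

/-- The V-rank is monotone. [folklore] -/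
theorem vrank_mono {t t' : ℕ} (h : t ≤ t') : vrank R t ≤ vrank R t' :=
  card_le_card fun i hi => by
    rw [mem_filter] at hi ⊢
    exact ⟨hi.1, lt_of_lt_of_le hi.2 h⟩

/-- The V-rank is at most the position. [folklore] -/
theorem vrank_le (t : ℕ) : vrank R t ≤ t := by
  unfold vrank
  calc (Rᶜ.filter fun i : Fin N => (i : ℕ) < t).card
      ≤ ((univ : Finset (Fin N)).filter fun i : Fin N => (i : ℕ) < t).card :=
        card_le_card (filter_subset_filter _ (subset_univ _))
    _ ≤ (Finset.range t).card := by
        refine card_le_card_of_injOn (fun i => (i : ℕ)) (fun i hi => ?_) ?_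
        · rw [mem_coe, mem_filter] at hi; rw [mem_coe, mem_range]; exact hi.2
        · intro a _ b _ hab; exact Fin.ext hab
    _ = t := card_range t

/-- The V-rank steps by one exactly at non-defect positions. [folklore] -/
theorem vrank_succ (t : Fin N) : vrank R ((t : ℕ) + 1) = vrank R t + (if t ∈ R then 0 else 1) := by
  classical
  unfold vrank
  have hset : (Rᶜ.filter fun i : Fin N => (i : ℕ) < (t : ℕ) + 1) =
      (Rᶜ.filter fun i : Fin N => (i : ℕ) < t) ∪ (if t ∈ R then ∅ else {t}) := by
    ext i
    simp only [mem_filter, mem_compl, mem_union]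
    constructor
    · rintro ⟨hiR, hlt⟩
      rcases Nat.lt_succ_iff_lt_or_eq.1 hlt with h | h
      · exact Or.inl ⟨hiR, h⟩
      · right
        have : i = t := Fin.ext h
        subst this
        rw [if_neg hiR]; exact mem_singleton_self _
    · rintro (⟨hiR, h⟩ | h)
      · exact ⟨hiR, Nat.lt_succ_of_lt h⟩
      · split_ifs at h with htR
        · exact absurd h (notMem_empty _)
        · rw [mem_singleton] at h; subst h; exact ⟨htR, Nat.lt_succ_self _⟩
  have hdisj : Disjoint (Rᶜ.filter fun i : Fin N => (i : ℕ) < t) (if t ∈ R then ∅ else {t}) := by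
    rw [disjoint_left]
    intro i hi hi'
    split_ifs at hi' with htR
    · exact absurd hi' (notMem_empty _)
    · rw [mem_singleton] at hi'; subst hi'
      exact lt_irrefl _ (mem_filter.1 hi).2
  rw [hset, card_union_of_disjoint hdisj]
  split_ifs <;> simp

/-- Beyond `N` the V-rank is `#Rᶜ`. [folklore] -/
theorem vrank_of_le {t : ℕ} (ht : N ≤ t) : vrank R t = Rᶜ.card := by
  unfold vrank
  congr 1
  exact filter_true_of_mem fun i _ => lt_of_lt_of_le i.isLt ht

/-- The V-rank is at most `#Rᶜ`. [folklore] -/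
theorem vrank_le_card (t : ℕ) : vrank R t ≤ Rᶜ.card := card_filter_le _ _

/-- `vpos i < N` for `i < #Rᶜ`. [folklore] -/
theorem vpos_lt {i : ℕ} (hi : i < Rᶜ.card) : vpos R i < N := by
  unfold vpos; rw [dif_pos hi]; exact Fin.isLt _

/-- `vpos i = N` for `i ≥ #Rᶜ`. [folklore] -/
theorem vpos_of_le {i : ℕ} (hi : Rᶜ.card ≤ i) : vpos R i = N := by
  unfold vpos; rw [dif_neg (not_lt.2 hi)]

/-- `vpos i ≤ N`. [folklore] -/
theorem vpos_le (i : ℕ) : vpos R i ≤ N := by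
  by_cases hi : i < Rᶜ.card
  · exact (vpos_lt R hi).le
  · exact (vpos_of_le R (not_lt.1 hi)).le

/-- The tail start is at most `N`. [folklore] -/
theorem tailStart_le (L m : ℕ) : tailStart R L m ≤ N := vpos_le R _

/-- The V-position of rank `i` as an element of `Fin N` is the `i`-th element of `Rᶜ`. [folklore] -/
theorem vpos_eq {i : ℕ} (hi : i < Rᶜ.card) :
    (⟨vpos R i, vpos_lt R hi⟩ : Fin N) = Rᶜ.orderEmbOfFin rfl ⟨i, hi⟩ := by
  apply Fin.ext
  simp only [vpos, dif_pos hi]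

/-- V-positions are non-defect. [folklore] -/
theorem vpos_not_mem {i : ℕ} (hi : i < Rᶜ.card) : (⟨vpos R i, vpos_lt R hi⟩ : Fin N) ∉ R := by
  rw [vpos_eq R hi, ← mem_compl]
  exact orderEmbOfFin_mem _ _ _

/-- **Exactly `i` non-defect positions precede the one of V-rank `i`.** [folklore] -/
theorem vrank_vpos {i : ℕ} (hi : i < Rᶜ.card) : vrank R (vpos R i) = i := by
  have h := card_filter_lt_orderEmbOfFin (rfl : Rᶜ.card = Rᶜ.card) ⟨i, hi⟩
  rw [← vpos_eq R hi] at h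
  have e := vrank_coe R ⟨vpos R i, vpos_lt R hi⟩
  exact e.trans h

/-- **A non-defect position is the V-position of its V-rank.** [folklore] -/
theorem vpos_vrank {t : Fin N} (ht : t ∉ R) : vpos R (vrank R t) = t := by
  have htc : t ∈ Rᶜ := mem_compl.2 ht
  have hlt : vrank R t < Rᶜ.card := by
    rw [vrank_coe]; exact card_filter_lt_lt_card htc
  have h := orderEmbOfFin_card_filter_lt (rfl : Rᶜ.card = Rᶜ.card) htc
  have hidx : (⟨vrank R t, hlt⟩ : Fin Rᶜ.card) =
      ⟨(Rᶜ.filter fun i => i < t).card, card_filter_lt_lt_card htc⟩ := Fin.ext (vrank_coe R t)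
  unfold vpos
  rw [dif_pos hlt, hidx, h]

/-- `vpos` is strictly monotone below `#Rᶜ`. [folklore] -/
theorem vpos_lt_vpos {i j : ℕ} (hij : i < j) (hj : j < Rᶜ.card) : vpos R i < vpos R j := by
  have hi : i < Rᶜ.card := hij.trans hj
  have := (Rᶜ.orderEmbOfFin rfl).lt_iff_lt.2 (show (⟨i, hi⟩ : Fin Rᶜ.card) < ⟨j, hj⟩ from hij)
  rw [← vpos_eq R hi, ← vpos_eq R hj] at this
  exact this

/-- The V-rank of a non-defect position is below `#Rᶜ`. [folklore] -/
theorem vrank_lt_card {t : Fin N} (ht : t ∉ R) : vrank R t < Rᶜ.card := by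
  rw [vrank_coe]; exact card_filter_lt_lt_card (mem_compl.2 ht)

/-! ### Openers are non-defect: the FIFO pairing avoids `R × R` -/

/-- **Every opener of the inflated word is a non-defect position** (S1). [folklore] -/
theorem not_mem_of_inflateWord (L m : ℕ) (y : Fin (2 * (Rᶜ.card / 2)) → Bool) {t : Fin N}
    (ht : inflateWord R L m y t = true) : t ∉ R := fun h => by
  rw [inflateWord_apply_of_mem R L m y h] at ht
  exact Bool.false_ne_true ht

/-- **The FIFO pairing of the inflated word avoids `R × R`**: a defect position is a closer, hence paired with an
opener, which is a non-defect position (supp μ ⊆ 𝓕_R, SPEC S1). [folklore] -/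
theorem fifo_inflateWord_not_mem (L m : ℕ) (y : Fin (2 * (Rᶜ.card / 2)) → Bool)
    (h : (closerSet (inflateWord R L m y)).card = (openerSet (inflateWord R L m y)).card)
    {i : Fin N} (hi : i ∈ R) : fifo (inflateWord R L m y) h i ∉ R := by
  have hWi : inflateWord R L m y i = false := inflateWord_apply_of_mem R L m y hi
  obtain ⟨k, rfl⟩ := exists_eq_closer h hWi
  rw [fifo_closer]
  exact not_mem_of_inflateWord R L m y (apply_opener k)

/-! ### The strict past: letters before pair `j` only read bits below `2j` -/

/-- **Strict-past agreement.**  If two bit strings agree on the bits below `2j`, the two inflated words agree at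
every position of V-rank `< 2j` before the tail. [folklore] -/
theorem inflateWord_eq_of_agree (L m : ℕ) {y y' : Fin (2 * (Rᶜ.card / 2)) → Bool} {j : ℕ}
    (hyy' : ∀ b : Fin (2 * (Rᶜ.card / 2)), (b : ℕ) < 2 * j → y b = y' b)
    {t : Fin N} (ht : vrank R t < 2 * j) (htail : vrank R t < 2 * tailPairs R L m) :
    inflateWord R L m y t = inflateWord R L m y' t := by
  by_cases htR : t ∈ R
  · rw [inflateWord_apply_of_mem R L m y htR, inflateWord_apply_of_mem R L m y' htR]
  rw [inflateWord_apply_of_lt R L m y htR htail, inflateWord_apply_of_lt R L m y' htR htail]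
  -- `preLetter` at V-rank `i < 2j` reads bits `2(i/2), 2(i/2)+1 < 2j`
  set i := vrank R t with hi
  unfold preLetter
  by_cases hhead : i < 2 * headPairs R L m
  · rw [if_pos hhead, if_pos hhead]
  rw [if_neg hhead, if_neg hhead]
  have hb0 : ∀ (h : 2 * (i / 2) < 2 * (Rᶜ.card / 2)), y ⟨2 * (i / 2), h⟩ = y' ⟨2 * (i / 2), h⟩ :=
    fun h => hyy' _ (by simp only; omega)
  have hb1 : ∀ (h : 2 * (i / 2) + 1 < 2 * (Rᶜ.card / 2)), y ⟨2 * (i / 2) + 1, h⟩ = y' ⟨2 * (i / 2) + 1, h⟩ :=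
    fun h => hyy' _ (by simp only; omega)
  have e0 : (if h : 2 * (i / 2) < 2 * (Rᶜ.card / 2) then y ⟨2 * (i / 2), h⟩ else false)
      = (if h : 2 * (i / 2) < 2 * (Rᶜ.card / 2) then y' ⟨2 * (i / 2), h⟩ else false) := by
    split_ifs with h
    · exact hb0 h
    · rfl
  have e1 : (if h : 2 * (i / 2) + 1 < 2 * (Rᶜ.card / 2) then y ⟨2 * (i / 2) + 1, h⟩ else false)
      = (if h : 2 * (i / 2) + 1 < 2 * (Rᶜ.card / 2) then y' ⟨2 * (i / 2) + 1, h⟩ else false) := by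
    split_ifs with h
    · exact hb1 h
    · rfl
  rw [e0, e1]


/-! ### The `need` recursion unfolded -/

variable (L m : ℕ)

/-- One step of the recursion below the tail start, at a DEFECT position. [folklore] -/
theorem need_of_mem {t : Fin N} (ht : t ∈ R) (hlt : (t : ℕ) < tailStart R L m) :
    need R L m t = need R L m ((t : ℕ) + 1) + 1 := by
  have hk : tailStart R L m - (t : ℕ) = (tailStart R L m - ((t : ℕ) + 1)) + 1 := by omega
  unfold need
  rw [if_pos hlt, hk, needAux]
  have hne : (R.filter fun i : Fin N => (i : ℕ) = tailStart R L m - (tailStart R L m - ((t : ℕ) + 1) + 1)).Nonempty :=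
    ⟨t, mem_filter.2 ⟨ht, by omega⟩⟩
  rw [if_pos hne]
  by_cases h1 : (t : ℕ) + 1 < tailStart R L m
  · rw [if_pos h1]
  · rw [if_neg h1]
    have : tailStart R L m - ((t : ℕ) + 1) = 0 := by omega
    rw [this, needAux]

/-- The filter «defect at position `u`» is empty at a non-defect position. [folklore] -/
theorem filter_eq_not_nonempty {t : Fin N} (ht : t ∉ R) :
    ¬ (R.filter fun i : Fin N => (i : ℕ) = (t : ℕ)).Nonempty := by
  rintro ⟨i, hi⟩
  rw [mem_filter] at hi
  have : i = t := Fin.ext hi.2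
  subst this
  exact ht hi.1

/-- One step at a NON-DEFECT position: `need t = need (t+1) − 1` if `t` is a pair start (even V-rank) with
`need (t+1) > 0` (an inflation pair), else `need t = need (t+1)`. [folklore] -/
theorem need_of_not_mem {t : Fin N} (ht : t ∉ R) (hlt : (t : ℕ) < tailStart R L m) :
    need R L m t =
      if vrank R t % 2 = 0 ∧ 0 < need R L m ((t : ℕ) + 1) then need R L m ((t : ℕ) + 1) - 1
      else need R L m ((t : ℕ) + 1) := by
  have hk : tailStart R L m - (t : ℕ) = (tailStart R L m - ((t : ℕ) + 1)) + 1 := by omega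
  have hsub : tailStart R L m - (tailStart R L m - ((t : ℕ) + 1) + 1) = (t : ℕ) := by omega
  -- value of `need (t+1)` in terms of `needAux`
  have hnext : need R L m ((t : ℕ) + 1) = needAux R (tailStart R L m) (tailStart R L m - ((t : ℕ) + 1)) := by
    unfold need
    by_cases h1 : (t : ℕ) + 1 < tailStart R L m
    · rw [if_pos h1]
    · rw [if_neg h1]
      have : tailStart R L m - ((t : ℕ) + 1) = 0 := by omega
      rw [this, needAux]
  conv_lhs => unfold need
  rw [if_pos hlt, hk, needAux, hsub, if_neg (filter_eq_not_nonempty R ht), ← hnext]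
  simp only [t.isLt, true_and]

/-- **Closed form of `need`.**  For `t ≤ E′`: `need t + #{inflation pair starts in [t, E′)} = #(R ∩ [t, E′))`,
where an inflation pair start is a non-defect position `s` of even V-rank with `need (s+1) > 0`. In particular the
envelope `L + need` falls by one across each defect and rises by one across each inflation pair start. [folklore] -/
theorem need_add_card_eq (t : ℕ) (ht : t ≤ tailStart R L m) :
    need R L m t +
        ((univ : Finset (Fin N)).filter fun s : Fin N => t ≤ (s : ℕ) ∧ (s : ℕ) < tailStart R L m ∧ s ∉ R ∧
          vrank R s % 2 = 0 ∧ 0 < need R L m ((s : ℕ) + 1)).card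
      = (R.filter fun s : Fin N => t ≤ (s : ℕ) ∧ (s : ℕ) < tailStart R L m).card := by
  classical
  -- downward induction on `t` from `E′`
  obtain ⟨d, rfl⟩ : ∃ d, t = tailStart R L m - d := ⟨tailStart R L m - t, by omega⟩
  induction d with
  | zero =>
    rw [Nat.sub_zero, need_of_le R L m le_rfl]
    rw [Finset.filter_false_of_mem, Finset.filter_false_of_mem]
    · simp
    · intro s _ h; omega
    · intro s _ h; omega
  | succ d ih =>
    by_cases hd : tailStart R L m < d + 1
    · -- then both `t`'s are `0`… reduce to the case `t = 0` handled by `d` with `E′ − d = 0` too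
      have h0 : tailStart R L m - (d + 1) = tailStart R L m - d := by omega
      rw [h0]; exact ih (by omega)
    rw [not_lt] at hd
    set u := tailStart R L m - (d + 1) with hu
    have hu1 : tailStart R L m - d = u + 1 := by omega
    rw [hu1] at ih
    have huN : u < N := by
      have := tailStart_le R L m
      omega
    set uF : Fin N := ⟨u, huN⟩ with huF
    have hult : (uF : ℕ) < tailStart R L m := by show u < _; omega
    -- split the two filters at `u`
    have splitR : (R.filter fun s : Fin N => u ≤ (s : ℕ) ∧ (s : ℕ) < tailStart R L m) =
        (if uF ∈ R then {uF} else ∅) ∪ (R.filter fun s : Fin N => u + 1 ≤ (s : ℕ) ∧ (s : ℕ) < tailStart R L m) := by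
      ext s
      simp only [mem_filter, mem_union]
      constructor
      · rintro ⟨hsR, h1, h2⟩
        rcases Nat.eq_or_lt_of_le h1 with h | h
        · left
          have : s = uF := Fin.ext h.symm
          subst this; rw [if_pos hsR]; exact mem_singleton_self _
        · exact Or.inr ⟨hsR, h, h2⟩
      · rintro (h | ⟨hsR, h1, h2⟩)
        · split_ifs at h with hm
          · rw [mem_singleton] at h; subst h; exact ⟨hm, le_rfl, hult⟩
          · exact absurd h (notMem_empty _)
        · exact ⟨hsR, by omega, h2⟩
    have splitI : ((univ : Finset (Fin N)).filter fun s : Fin N => u ≤ (s : ℕ) ∧ (s : ℕ) < tailStart R L m ∧ s ∉ R ∧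
          vrank R s % 2 = 0 ∧ 0 < need R L m ((s : ℕ) + 1)) =
        (if uF ∉ R ∧ vrank R uF % 2 = 0 ∧ 0 < need R L m (u + 1) then {uF} else ∅) ∪
          ((univ : Finset (Fin N)).filter fun s : Fin N => u + 1 ≤ (s : ℕ) ∧ (s : ℕ) < tailStart R L m ∧ s ∉ R ∧
            vrank R s % 2 = 0 ∧ 0 < need R L m ((s : ℕ) + 1)) := by
      ext s
      simp only [mem_filter, mem_univ, true_and, mem_union]
      constructor
      · rintro ⟨h1, h2, h3, h4, h5⟩
        rcases Nat.eq_or_lt_of_le h1 with h | h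
        · left
          have : s = uF := Fin.ext h.symm
          subst this; rw [if_pos ⟨h3, h4, h5⟩]; exact mem_singleton_self _
        · exact Or.inr ⟨h, h2, h3, h4, h5⟩
      · rintro (h | ⟨h1, h2, h3, h4, h5⟩)
        · split_ifs at h with hm
          · rw [mem_singleton] at h; subst h; exact ⟨le_rfl, hult, hm.1, hm.2.1, hm.2.2⟩
          · exact absurd h (notMem_empty _)
        · exact ⟨by omega, h2, h3, h4, h5⟩
    have disjR : Disjoint (if uF ∈ R then ({uF} : Finset (Fin N)) else ∅)
        (R.filter fun s : Fin N => u + 1 ≤ (s : ℕ) ∧ (s : ℕ) < tailStart R L m) := by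
      rw [disjoint_left]; intro s hs hs'
      split_ifs at hs
      · rw [mem_singleton] at hs; subst hs; have := (mem_filter.1 hs').2.1; simp [huF] at this
      · exact absurd hs (notMem_empty _)
    have disjI : Disjoint (if uF ∉ R ∧ vrank R uF % 2 = 0 ∧ 0 < need R L m (u + 1) then ({uF} : Finset (Fin N)) else ∅)
        ((univ : Finset (Fin N)).filter fun s : Fin N => u + 1 ≤ (s : ℕ) ∧ (s : ℕ) < tailStart R L m ∧ s ∉ R ∧
            vrank R s % 2 = 0 ∧ 0 < need R L m ((s : ℕ) + 1)) := by
      rw [disjoint_left]; intro s hs hs'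
      split_ifs at hs
      · rw [mem_singleton] at hs; subst hs; have := (mem_filter.1 hs').2.1; simp [huF] at this
      · exact absurd hs (notMem_empty _)
    rw [splitR, splitI, card_union_of_disjoint disjR, card_union_of_disjoint disjI]
    -- the step of `need` at `u`
    by_cases huR : uF ∈ R
    · rw [show need R L m u = need R L m (u + 1) + 1 from need_of_mem R L m huR hult, if_pos huR,
        if_neg (fun h => h.1 huR), card_singleton, card_empty]
      omega
    · have hstep := need_of_not_mem R L m huR hult
      simp only [huF] at hstep
      rw [if_neg huR, card_empty]
      by_cases hinf : vrank R uF % 2 = 0 ∧ 0 < need R L m (u + 1)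
      · rw [if_pos ⟨huR, hinf⟩, card_singleton]
        rw [if_pos (by simpa [huF] using hinf)] at hstep
        have hpos := hinf.2
        rw [show need R L m u = need R L m (u + 1) - 1 from hstep]
        omega
      · rw [if_neg (fun h => hinf h.2), card_empty]
        rw [if_neg (by simpa [huF] using hinf)] at hstep
        rw [show need R L m u = need R L m (u + 1) from hstep]
        omega


end Summit.ValiantsHypothesis.ValiantsHypothesis.Theorems.FifoMatching.NNLinearDegreeCofactorHard.InflateWord

end
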